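import Mathlib
import Summits.ValiantsHypothesis.ValiantsHypothesis.Theorems.BarrierLeverPartitionMinorsHitByVPHiddenStatesSecondShellExchange
import Summits.ValiantsHypothesis.ValiantsHypothesis.Theorems.BarrierLeverPartitionMinorsHitByVPHiddenStatesSecondShellChainIdentity

/-!
# Route BarrierLever — item `PartitionMinorsHitByVP` (stmt-ValiantsHypothesis-19717), line `hidden-states`:
# ★ THE THREE-MOVER CHAIN LEMMA — a digraph-parametrised cancellation of cross minors (every table, every `t, h`)

Helper file (`--supports stmt-ValiantsHypothesis-19717`; cell valiant-natproofs, 𝒟-side door (c), registered line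
`Cruxes/PartitionMinorsHitByVP/Lines/hidden_states.lean` v8; prover seat val-np-p6 gen 18).  Closes NO item; definition-free.

THE MECHANISM (memo HOME/val-np-p6/g17/MEMO-valnp6-g17.md §4b–§4d «three movers», and this seat's memo).  A cross minor
`D(A ← C')` of the exchange composition (`…SecondShellExchange`) has the start row `C' = Z ∪ {a, b, c}` against all rows of
size `≤ t = |Z| + 2` except `A`.  Suppose that, for the table `w` («coordinate `u` of the hidden point of `J` is `Σ_{q ∈ J} w u q`»),
the rows of `Z` are unit rows, the three MOVERS form a CHAIN — `b` reads `a` (weight `σ = w b a`), `c` reads `b` (`τ = w c b`),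
`a` reads neither `b` nor `c`, `b` does not read `c`, `c` does not read `a` — and every EXIT (a coordinate outside `Z ∪ {a,b,c}`
read by a mover, weights `α_d = w a d`, `β_d = w b d`, `γ_d = w c d`) has a unit row.  Then on every column `J` of size
`≤ |Z| + 2` the start row is an EXPLICIT combination of the rows `Z ∪ T`, `|T| ≤ 2` (★ `det_eq_zero_of_chain₃`; coefficients
= the statement of `…SecondShellChainIdentity.chain₃_column_identity`): with `a₀, b₀, c₀` the (constant) contributions of `Z` to the three movers,
`λ_∅ = a₀(b₀+σ)(c₀+τ)`, `λ_a = −(b₀+σ)(c₀+τ)`, `λ_b = −a₀(c₀+τ)`, `λ_c = −a₀(b₀+σ)`, `λ_{ab} = c₀+τ`, `λ_{ac} = b₀+σ`,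
`λ_{bc} = a₀`, `λ_d = −2α_dβ_dγ_d − c₀α_dβ_d − b₀α_dγ_d − a₀β_dγ_d + τa₀β_d + σc₀α_d + στα_d(1+α_d+a₀)`,
`λ_{ad} = β_dγ_d − τβ_d − στα_d`, `λ_{bd} = α_dγ_d`, `λ_{cd} = α_dβ_d − σα_d`, and the ONLY pure-exit pairs are
`λ_{dd'} = 2στ·α_d·α_{d'}` — PAIRS OF EXITS OF THE BOTTOM MOVER `a`.  Hence the minor vanishes as soon as every needed row
`Z ∪ T` other than `A` is present, i.e. unless `A = Z ∪ {d, d'}` for two `a`-exits.  This one lemma reproduces the four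
per-shape identities of gen 17 (`nested_budget_identity`, `…'`, `…₂`, `…_shared` are the instances chain `p → b → m`,
`m`-exits `q₁, q₂`, `b`-exit `x`) and gives the PARALLEL NESTED cell (`…SecondShellParallelNested`): chain `c → b → a` of
path 2 = (a < b < c < m) over path 1 = (a < b < c), `a`-exits `x₀, x₁, f₀, f₁`, `b`-exit `f` — for any coincidences
`x_i = f_j` and any inert exits, because the weights are symbolic.

HONEST LABEL: conjecture-column toolkit (second shell, every `t, h`); 19717 stays OPEN; nothing on crux 14610 or VP ≠ VNP.
-/

set_option linter.dupNamespace false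

namespace Summit.ValiantsHypothesis.ValiantsHypothesis.Theorems.BarrierLever.HiddenStates

open Finset

noncomputable section

namespace SecondShell

variable {α : Type} [Fintype α] [DecidableEq α]

/-! ## ★ The three-mover chain lemma -/

/-- ★ **THE THREE-MOVER CHAIN LEMMA.**  For ANY table `w`: if the start row `rows i₀ = Z ∪ {a,b,c}` has unit rows on `Z`, its three
movers form a chain (`b` reads `a`, `c` reads `b`; `a` reads neither `b` nor `c`, `b` does not read `c`, `c` does not read `a`),
every exit read by a mover has a unit row, the columns have size `≤ |Z| + 2`, and every row `Z ∪ T` (`T` disjoint from `Z`,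
`|T| ≤ 2`, `T ⊆` movers ∪ read exits) is present among the other rows EXCEPT possibly the pure pairs `T = {d, d'}` with
`w a d = 0` or `w a d' = 0` — then the determinant vanishes. -/
theorem det_eq_zero_of_chain₃ (w : α → α → ℂ) {r : ℕ} (rows cols : Fin r → Finset α) (i₀ : Fin r)
    (Z : Finset α) {a b c : α} (hab : a ≠ b) (hac : a ≠ c) (hbc : b ≠ c)
    (haZ : a ∉ Z) (hbZ : b ∉ Z) (hcZ : c ∉ Z)
    (hrow : rows i₀ = insert a (insert b (insert c Z)))
    (hZ : ∀ z ∈ Z, ∀ q, w z q = if q = z then 1 else 0)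
    (haa : w a a = 1) (hab₀ : w a b = 0) (hac₀ : w a c = 0)
    (hbb : w b b = 1) (hbc₀ : w b c = 0) (hcc : w c c = 1) (hca₀ : w c a = 0)
    (hD : ∀ d, d ∉ Z → d ≠ a → d ≠ b → d ≠ c → (w a d ≠ 0 ∨ w b d ≠ 0 ∨ w c d ≠ 0) →
      ∀ q, w d q = if q = d then 1 else 0)
    (hcol : ∀ kk, (cols kk).card ≤ Z.card + 2)
    (hall : ∀ T : Finset α, Disjoint T Z → T.card ≤ 2 →
      (∀ d ∈ T, d ≠ a → d ≠ b → d ≠ c → (w a d ≠ 0 ∨ w b d ≠ 0 ∨ w c d ≠ 0)) →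
      (T.card = 2 → a ∉ T → b ∉ T → c ∉ T → ∀ d ∈ T, w a d ≠ 0) →
      ∃ i, i ≠ i₀ ∧ rows i = T ∪ Z) :
    (mat w rows cols).det = 0 := by
  classical
  set Mx : Matrix (Fin r) (Fin r) ℂ := mat w rows cols with hMx
  -- the read exits `D` and the bottom exits `Da` (opaque names with membership lemmas)
  obtain ⟨D, hDdef⟩ : ∃ D : Finset α, D = (Finset.univ \ insert a (insert b (insert c Z))).filter
      (fun d => w a d ≠ 0 ∨ w b d ≠ 0 ∨ w c d ≠ 0) := ⟨_, rfl⟩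
  have hDiff : ∀ d, d ∈ D ↔ (d ≠ a ∧ d ≠ b ∧ d ≠ c ∧ d ∉ Z) ∧ (w a d ≠ 0 ∨ w b d ≠ 0 ∨ w c d ≠ 0) := by
    intro d
    rw [hDdef, Finset.mem_filter, Finset.mem_sdiff]
    simp only [Finset.mem_univ, true_and, Finset.mem_insert, not_or]
  have hDmem : ∀ d ∈ D, d ∉ Z ∧ d ≠ a ∧ d ≠ b ∧ d ≠ c ∧ (w a d ≠ 0 ∨ w b d ≠ 0 ∨ w c d ≠ 0) := by
    intro d hd
    have h := (hDiff d).1 hd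
    exact ⟨h.1.2.2.2, h.1.1, h.1.2.1, h.1.2.2.1, h.2⟩
  obtain ⟨Da, hDadef⟩ : ∃ Da : Finset α, Da = D.filter (fun d => w a d ≠ 0) := ⟨_, rfl⟩
  have hDaiff : ∀ d, d ∈ Da ↔ d ∈ D ∧ w a d ≠ 0 := by intro d; rw [hDadef, Finset.mem_filter]
  have hDa : ∀ d ∈ Da, d ∈ D ∧ w a d ≠ 0 := fun d hd => (hDaiff d).1 hd
  have hDaD : Da ⊆ D := fun d hd => (hDa d hd).1
  have hDunit : ∀ d ∈ D, ∀ q, w d q = if q = d then 1 else 0 := fun d hd =>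
    hD d (hDmem d hd).1 (hDmem d hd).2.1 (hDmem d hd).2.2.1 (hDmem d hd).2.2.2.1 (hDmem d hd).2.2.2.2
  -- weights
  set σ : ℂ := w b a with hσ
  set τ : ℂ := w c b with hτ
  set a₀ : ℂ := ∑ z ∈ Z, w a z with ha₀
  set b₀ : ℂ := ∑ z ∈ Z, w b z with hb₀
  set c₀ : ℂ := ∑ z ∈ Z, w c z with hc₀
  -- the needed rows
  let Need : Finset α → Prop := fun T => Disjoint T Z ∧ T.card ≤ 2 ∧
      (∀ d ∈ T, d ≠ a → d ≠ b → d ≠ c → (w a d ≠ 0 ∨ w b d ≠ 0 ∨ w c d ≠ 0)) ∧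
      (T.card = 2 → a ∉ T → b ∉ T → c ∉ T → ∀ d ∈ T, w a d ≠ 0)
  have hall' : ∀ T, Need T → ∃ i, i ≠ i₀ ∧ rows i = T ∪ Z := fun T h => hall T h.1 h.2.1 h.2.2.1 h.2.2.2
  let idx : Finset α → Fin r := fun T => if h : Need T then Classical.choose (hall' T h) else i₀
  have hidx : ∀ T, Need T → idx T ≠ i₀ ∧ rows (idx T) = T ∪ Z := by
    intro T h
    simp only [idx, dif_pos h]
    exact Classical.choose_spec (hall' T h)
  have hspan : ∀ T, Need T → Mx (idx T) ∈ Submodule.span ℂ (Mx '' {i | i ≠ i₀}) :=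
    fun T h => Submodule.subset_span ⟨idx T, (hidx T h).1, rfl⟩
  -- `Need` for the shapes we use
  have hmov : ∀ x, x = a ∨ x = b ∨ x = c → x ≠ a → x ≠ b → x ≠ c → (w a x ≠ 0 ∨ w b x ≠ 0 ∨ w c x ≠ 0) := by
    rintro x (rfl | rfl | rfl) h1 h2 h3
    · exact absurd rfl h1
    · exact absurd rfl h2
    · exact absurd rfl h3
  have need0 : Need ∅ := ⟨Finset.disjoint_empty_left _, by simp, by simp, by simp⟩
  have need1 : ∀ x, x ∉ Z → (x ≠ a → x ≠ b → x ≠ c → (w a x ≠ 0 ∨ w b x ≠ 0 ∨ w c x ≠ 0)) → Need {x} := by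
    intro x hx hr
    refine ⟨Finset.disjoint_singleton_left.2 hx, by simp, ?_, by simp⟩
    intro d hd; rw [Finset.mem_singleton] at hd; subst hd; exact hr
  have need2 : ∀ x y, x ≠ y → x ∉ Z → y ∉ Z →
      (x ≠ a → x ≠ b → x ≠ c → (w a x ≠ 0 ∨ w b x ≠ 0 ∨ w c x ≠ 0)) →
      (y ≠ a → y ≠ b → y ≠ c → (w a y ≠ 0 ∨ w b y ≠ 0 ∨ w c y ≠ 0)) →
      ((x = a ∨ x = b ∨ x = c) ∨ (w a x ≠ 0 ∧ w a y ≠ 0)) → Need {x, y} := by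
    intro x y hxy hx hy hrx hry hlast
    refine ⟨?_, by rw [Finset.card_pair hxy], ?_, ?_⟩
    · rw [Finset.disjoint_insert_left, Finset.disjoint_singleton_left]; exact ⟨hx, hy⟩
    · intro d hd
      rw [Finset.mem_insert, Finset.mem_singleton] at hd
      rcases hd with rfl | rfl
      · exact hrx
      · exact hry
    · intro _ h1 h2 h3 d hd
      rw [Finset.mem_insert, Finset.mem_singleton] at hd
      rcases hlast with (hxa | hxb | hxc) | ⟨hwx, hwy⟩
      · exact absurd (by rw [hxa]; exact Finset.mem_insert_self _ _) h1
      · exact absurd (by rw [hxb]; exact Finset.mem_insert_self _ _) h2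
      · exact absurd (by rw [hxc]; exact Finset.mem_insert_self _ _) h3
      · rcases hd with rfl | rfl
        · exact hwx
        · exact hwy
  have needa : Need {a} := need1 a haZ (hmov a (Or.inl rfl))
  have needb : Need {b} := need1 b hbZ (hmov b (Or.inr (Or.inl rfl)))
  have needc : Need {c} := need1 c hcZ (hmov c (Or.inr (Or.inr rfl)))
  have needab : Need {a, b} :=
    need2 a b hab haZ hbZ (hmov a (Or.inl rfl)) (hmov b (Or.inr (Or.inl rfl))) (Or.inl (Or.inl rfl))
  have needac : Need {a, c} :=
    need2 a c hac haZ hcZ (hmov a (Or.inl rfl)) (hmov c (Or.inr (Or.inr rfl))) (Or.inl (Or.inl rfl))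
  have needbc : Need {b, c} :=
    need2 b c hbc hbZ hcZ (hmov b (Or.inr (Or.inl rfl))) (hmov c (Or.inr (Or.inr rfl))) (Or.inl (Or.inr (Or.inl rfl)))
  have needd : ∀ d ∈ D, Need {d} := fun d hd => need1 d (hDmem d hd).1 (fun _ _ _ => (hDmem d hd).2.2.2.2)
  have needad : ∀ d ∈ D, Need {a, d} := fun d hd =>
    need2 a d (Ne.symm (hDmem d hd).2.1) haZ (hDmem d hd).1 (hmov a (Or.inl rfl)) (fun _ _ _ => (hDmem d hd).2.2.2.2)
      (Or.inl (Or.inl rfl))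
  have needbd : ∀ d ∈ D, Need {b, d} := fun d hd =>
    need2 b d (Ne.symm (hDmem d hd).2.2.1) hbZ (hDmem d hd).1 (hmov b (Or.inr (Or.inl rfl)))
      (fun _ _ _ => (hDmem d hd).2.2.2.2) (Or.inl (Or.inr (Or.inl rfl)))
  have needcd : ∀ d ∈ D, Need {c, d} := fun d hd =>
    need2 c d (Ne.symm (hDmem d hd).2.2.2.1) hcZ (hDmem d hd).1 (hmov c (Or.inr (Or.inr rfl)))
      (fun _ _ _ => (hDmem d hd).2.2.2.2) (Or.inl (Or.inr (Or.inr rfl)))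
  have needdd : ∀ d ∈ Da, ∀ d' ∈ Da.erase d, Need {d, d'} := by
    intro d hd d' hd'
    obtain ⟨hd'd, hd'D⟩ := Finset.mem_erase.1 hd'
    exact need2 d d' (Ne.symm hd'd) (hDmem d (hDa d hd).1).1 (hDmem d' (hDa d' hd'D).1).1
      (fun _ _ _ => (hDmem d (hDa d hd).1).2.2.2.2) (fun _ _ _ => (hDmem d' (hDa d' hd'D).1).2.2.2.2)
      (Or.inr ⟨(hDa d hd).2, (hDa d' hd'D).2⟩)
  -- exit coefficients
  let lam₁ : α → ℂ := fun d => -2 * w a d * w b d * w c d - c₀ * w a d * w b d - b₀ * w a d * w c d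
      - a₀ * w b d * w c d + τ * a₀ * w b d + σ * c₀ * w a d + σ * τ * w a d * (1 + w a d + a₀)
  let lama : α → ℂ := fun d => w b d * w c d - τ * w b d - σ * τ * w a d
  let lamb : α → ℂ := fun d => w a d * w c d
  let lamc : α → ℂ := fun d => w a d * w b d - σ * w a d
  -- ★ the relation among the rows
  have hrel : Mx i₀ =
      (a₀ * (b₀ + σ) * (c₀ + τ)) • Mx (idx ∅) + (-((b₀ + σ) * (c₀ + τ))) • Mx (idx {a})
        + (-(a₀ * (c₀ + τ))) • Mx (idx {b}) + (-(a₀ * (b₀ + σ))) • Mx (idx {c})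
        + (c₀ + τ) • Mx (idx {a, b}) + (b₀ + σ) • Mx (idx {a, c}) + a₀ • Mx (idx {b, c})
        + ∑ d ∈ D, (lam₁ d • Mx (idx {d}) + lama d • Mx (idx {a, d}) + lamb d • Mx (idx {b, d})
            + lamc d • Mx (idx {c, d}))
        + ∑ d ∈ Da, ∑ d' ∈ Da.erase d, (σ * τ * w a d * w a d') • Mx (idx {d, d'}) := by
    funext kk
    simp only [Pi.add_apply, Finset.sum_apply, Pi.smul_apply, smul_eq_mul]
    set J : Finset α := cols kk with hJ
    set Y : α → ℂ := fun u => ∑ q ∈ J, w u q with hY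
    set Φ : ℂ := ∏ z ∈ Z, Y z with hΦ
    -- row values
    have hval : ∀ T, Need T → Mx (idx T) kk = (∏ u ∈ T, Y u) * Φ := by
      intro T h
      have h1 := (hidx T h).2
      simp only [hMx, mat, Matrix.of_apply]
      rw [h1, Finset.prod_union h.1]
    have hval₀ : Mx i₀ kk = Y a * Y b * Y c * Φ := by
      simp only [hMx, mat, Matrix.of_apply]
      rw [hrow, Finset.prod_insert (by simp [hab, hac, haZ]), Finset.prod_insert (by simp [hbc, hbZ]),
        Finset.prod_insert hcZ]
      simp only [hY, hΦ]; ring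
    rw [hval₀, hval ∅ need0, hval {a} needa, hval {b} needb, hval {c} needc, hval {a, b} needab, hval {a, c} needac,
      hval {b, c} needbc, Finset.prod_empty, Finset.prod_singleton, Finset.prod_singleton, Finset.prod_singleton,
      Finset.prod_pair hab, Finset.prod_pair hac, Finset.prod_pair hbc]
    rw [Finset.sum_congr rfl (fun d hd => by
      rw [hval {d} (needd d hd), hval {a, d} (needad d hd), hval {b, d} (needbd d hd), hval {c, d} (needcd d hd),
        Finset.prod_singleton, Finset.prod_pair (Ne.symm (hDmem d hd).2.1), Finset.prod_pair (Ne.symm (hDmem d hd).2.2.1),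
        Finset.prod_pair (Ne.symm (hDmem d hd).2.2.2.1)])]
    rw [Finset.sum_congr rfl (fun d hd => Finset.sum_congr rfl (fun d' hd' => by
      rw [hval {d, d'} (needdd d hd d' hd'), Finset.prod_pair (Ne.symm (Finset.mem_erase.1 hd').1)]))]
    -- trivial when an inert token of `Z` is missing from the column
    rcases eq_or_ne Φ 0 with hΦ0 | hΦ0
    · simp only [hΦ0, mul_zero, add_zero, Finset.sum_const_zero]
    -- otherwise `Z ⊆ J`
    have hYZ : ∀ z ∈ Z, Y z = if z ∈ J then 1 else 0 := by
      intro z hz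
      simp only [hY]
      rw [Finset.sum_congr rfl (fun q _ => hZ z hz q), Finset.sum_ite_eq' J z]
    have hZJ : Z ⊆ J := by
      intro z hz
      by_contra hzJ
      exact hΦ0 (Finset.prod_eq_zero hz (by rw [hYZ z hz, if_neg hzJ]))
    -- indicators and the read exits inside the column
    obtain ⟨JD, hJDdef⟩ : ∃ JD : Finset α, JD = D.filter (· ∈ J) := ⟨_, rfl⟩
    have hJDiff : ∀ d, d ∈ JD ↔ d ∈ D ∧ d ∈ J := by intro d; rw [hJDdef, Finset.mem_filter]
    have hsumJD : ∀ f : α → ℂ, ∑ d ∈ D, (if d ∈ J then f d else 0) = ∑ d ∈ JD, f d := by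
      intro f; rw [hJDdef, Finset.sum_filter]
    set na : ℕ := if a ∈ J then 1 else 0 with hna
    set nb : ℕ := if b ∈ J then 1 else 0 with hnb
    set nc : ℕ := if c ∈ J then 1 else 0 with hnc
    have h01 : ∀ (P : Prop) [Decidable P], (if P then 1 else 0 : ℕ) = 0 ∨ (if P then 1 else 0 : ℕ) = 1 := by
      intro P _; by_cases hP : P
      · exact Or.inr (if_pos hP)
      · exact Or.inl (if_neg hP)
    -- the movers' values
    have hsplit : ∀ u, Y u = (∑ z ∈ Z, w u z) + ∑ q ∈ J \ Z, w u q := by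
      intro u
      simp only [hY]
      rw [← Finset.sum_union (Finset.disjoint_sdiff), Finset.union_sdiff_of_subset hZJ]
    have hind : ∀ (x : α) (y : ℂ), x ∉ Z → (if x ∈ J \ Z then y else 0) = ((if x ∈ J then 1 else 0 : ℕ) : ℂ) * y := by
      intro x y hx
      by_cases hxJ : x ∈ J
      · rw [if_pos (Finset.mem_sdiff.2 ⟨hxJ, hx⟩), if_pos hxJ]; simp
      · rw [if_neg (fun h' => hxJ (Finset.mem_sdiff.1 h').1), if_neg hxJ]; simp
    have hrest : ∀ u, (∀ q, q ∉ Z → q ≠ a → q ≠ b → q ≠ c → q ∉ D → w u q = 0) →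
        ∑ q ∈ J \ Z, w u q = (na : ℂ) * w u a + (nb : ℂ) * w u b + (nc : ℂ) * w u c + ∑ d ∈ JD, w u d := by
      intro u hu
      have hpt : ∀ q ∈ J \ Z, w u q = (if q = a then w u a else 0) + (if q = b then w u b else 0)
          + (if q = c then w u c else 0) + (if q ∈ D then w u q else 0) := by
        intro q hq
        have hqZ : q ∉ Z := (Finset.mem_sdiff.1 hq).2
        have haD : a ∉ D := fun h' => (hDmem a h').2.1 rfl
        have hbD : b ∉ D := fun h' => (hDmem b h').2.2.1 rfl
        have hcD : c ∉ D := fun h' => (hDmem c h').2.2.2.1 rfl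
        by_cases h1 : q = a
        · rw [h1]; simp [hab, hac, haD]
        by_cases h2 : q = b
        · rw [h2]; simp [hab.symm, hbc, hbD]
        by_cases h3 : q = c
        · rw [h3]; simp [hac.symm, hbc.symm, hcD]
        by_cases h4 : q ∈ D
        · simp [h1, h2, h3, h4]
        · simp [h1, h2, h3, h4, hu q hqZ h1 h2 h3 h4]
      rw [Finset.sum_congr rfl hpt, Finset.sum_add_distrib, Finset.sum_add_distrib, Finset.sum_add_distrib,
        Finset.sum_ite_eq' (J \ Z) a, Finset.sum_ite_eq' (J \ Z) b, Finset.sum_ite_eq' (J \ Z) c,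
        hind a _ haZ, hind b _ hbZ, hind c _ hcZ, ← Finset.sum_filter]
      have hf : (J \ Z).filter (· ∈ D) = JD := by
        ext q
        rw [Finset.mem_filter, Finset.mem_sdiff, hJDiff]
        constructor
        · rintro ⟨⟨hqJ, -⟩, hqD⟩; exact ⟨hqD, hqJ⟩
        · rintro ⟨hqD, hqJ⟩; exact ⟨⟨hqJ, (hDmem q hqD).1⟩, hqD⟩
      rw [hf]
    have hzero : ∀ u, (u = a ∨ u = b ∨ u = c) → ∀ q, q ∉ Z → q ≠ a → q ≠ b → q ≠ c → q ∉ D → w u q = 0 := by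
      intro u hu q hqZ h1 h2 h3 h4
      by_contra hne
      apply h4
      rw [hDiff]
      refine ⟨⟨h1, h2, h3, hqZ⟩, ?_⟩
      rcases hu with rfl | rfl | rfl
      · exact Or.inl hne
      · exact Or.inr (Or.inl hne)
      · exact Or.inr (Or.inr hne)
    have hYa : Y a = (na : ℂ) + a₀ + ∑ d ∈ JD, w a d := by
      rw [hsplit a, hrest a (hzero a (Or.inl rfl)), haa, hab₀, hac₀]; ring
    have hYb : Y b = (nb : ℂ) + σ * na + b₀ + ∑ d ∈ JD, w b d := by
      rw [hsplit b, hrest b (hzero b (Or.inr (Or.inl rfl))), hbb, hbc₀]; ring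
    have hYc : Y c = (nc : ℂ) + τ * nb + c₀ + ∑ d ∈ JD, w c d := by
      rw [hsplit c, hrest c (hzero c (Or.inr (Or.inr rfl))), hcc, hca₀]; ring
    -- the exits' values
    have hYd : ∀ d ∈ D, Y d = if d ∈ J then 1 else 0 := by
      intro d hd
      simp only [hY]
      rw [Finset.sum_congr rfl (fun q _ => hDunit d hd q), Finset.sum_ite_eq' J d]
    -- the budget
    have hbudget : JD.card + na + nb + nc ≤ 2 := by
      obtain ⟨M3, hM3⟩ : ∃ M3 : Finset α, M3 = ({a, b, c} : Finset α).filter (· ∈ J) := ⟨_, rfl⟩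
      have hM3iff : ∀ q, q ∈ M3 ↔ (q = a ∨ q = b ∨ q = c) ∧ q ∈ J := by
        intro q; rw [hM3, Finset.mem_filter, Finset.mem_insert, Finset.mem_insert, Finset.mem_singleton]
      have hsub : JD ∪ M3 ⊆ J \ Z := by
        intro q hq
        rw [Finset.mem_union, hJDiff, hM3iff] at hq
        rcases hq with ⟨hqD, hqJ⟩ | ⟨hq3, hqJ⟩
        · exact Finset.mem_sdiff.2 ⟨hqJ, (hDmem q hqD).1⟩
        · refine Finset.mem_sdiff.2 ⟨hqJ, ?_⟩
          rcases hq3 with rfl | rfl | rfl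
          · exact haZ
          · exact hbZ
          · exact hcZ
      have hdisj : Disjoint JD M3 := by
        rw [Finset.disjoint_left]
        intro q hq hq'
        rw [hJDiff] at hq
        rw [hM3iff] at hq'
        rcases hq'.1 with rfl | rfl | rfl
        · exact (hDmem q hq.1).2.1 rfl
        · exact (hDmem q hq.1).2.2.1 rfl
        · exact (hDmem q hq.1).2.2.2.1 rfl
      have hcard := Finset.card_le_card hsub
      rw [Finset.card_union_of_disjoint hdisj, Finset.card_sdiff_of_subset hZJ] at hcard
      have hM3c : M3.card = na + nb + nc := by
        rw [hM3, Finset.card_filter, Finset.sum_insert (by simp [hab, hac]), Finset.sum_pair hbc]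
        simp only [hna, hnb, hnc, add_assoc]
      have hJc : J.card ≤ Z.card + 2 := hcol kk
      omega
    -- the pieces on this column
    have hS1 : ∑ d ∈ D, (lam₁ d * (Y d * Φ) + lama d * (Y a * Y d * Φ) + lamb d * (Y b * Y d * Φ)
        + lamc d * (Y c * Y d * Φ)) =
        Φ * ∑ d ∈ JD, (lam₁ d + lama d * Y a + lamb d * Y b + lamc d * Y c) := by
      rw [← hsumJD, Finset.mul_sum]
      refine Finset.sum_congr rfl fun d hd => ?_
      rw [hYd d hd]
      split_ifs <;> ring
    have hS2 : ∑ d ∈ Da, ∑ d' ∈ Da.erase d, σ * τ * w a d * w a d' * (Y d * Y d' * Φ) =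
        Φ * (σ * τ * ((∑ d ∈ JD, w a d) ^ 2 - ∑ d ∈ JD, (w a d) ^ 2)) := by
      obtain ⟨JDa, hJDadef⟩ : ∃ JDa : Finset α, JDa = Da.filter (· ∈ J) := ⟨_, rfl⟩
      have hJDaiff : ∀ d, d ∈ JDa ↔ d ∈ Da ∧ d ∈ J := by intro d; rw [hJDadef, Finset.mem_filter]
      have hsumJDa : ∀ f : α → ℂ, ∑ d ∈ Da, (if d ∈ J then f d else 0) = ∑ d ∈ JDa, f d := by
        intro f; rw [hJDadef, Finset.sum_filter]
      have hin : ∀ d ∈ Da, ∑ d' ∈ Da.erase d, σ * τ * w a d * w a d' * (Y d * Y d' * Φ) =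
          Φ * (σ * τ) * (Y d * w a d) * ((∑ d' ∈ JDa, w a d') - (if d ∈ J then w a d else 0)) := by
        intro d hd
        have h1 : ∑ d' ∈ Da.erase d, σ * τ * w a d * w a d' * (Y d * Y d' * Φ) =
            Φ * (σ * τ) * (Y d * w a d) * ∑ d' ∈ Da.erase d, (if d' ∈ J then w a d' else 0) := by
          rw [Finset.mul_sum]
          refine Finset.sum_congr rfl fun d' hd' => ?_
          rw [hYd d' (hDaD (Finset.mem_erase.1 hd').2)]
          split_ifs <;> ring
        rw [h1, Finset.sum_erase_eq_sub hd, hsumJDa]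
      rw [Finset.sum_congr rfl hin]
      have h2 : ∑ d ∈ Da, Φ * (σ * τ) * (Y d * w a d) * ((∑ d' ∈ JDa, w a d') - (if d ∈ J then w a d else 0)) =
          Φ * (σ * τ) * ∑ d ∈ Da, (if d ∈ J then w a d * ((∑ d' ∈ JDa, w a d') - w a d) else 0) := by
        rw [Finset.mul_sum]
        refine Finset.sum_congr rfl fun d hd => ?_
        rw [hYd d (hDaD hd)]
        split_ifs <;> ring
      rw [h2, hsumJDa]
      have h3 : ∑ d ∈ JDa, w a d * ((∑ d' ∈ JDa, w a d') - w a d) =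
          (∑ d ∈ JDa, w a d) ^ 2 - ∑ d ∈ JDa, (w a d) ^ 2 := by
        rw [sq, Finset.sum_mul, ← Finset.sum_sub_distrib]
        refine Finset.sum_congr rfl fun d _ => ?_
        ring
      -- from `JDa` to `JD`: the extra exits have `w a d = 0`
      have hsub : JDa ⊆ JD := by
        intro d hd
        rw [hJDaiff] at hd
        exact (hJDiff d).2 ⟨hDaD hd.1, hd.2⟩
      have hvan : ∀ d ∈ JD, d ∉ JDa → w a d = 0 := by
        intro d hd hd'
        by_contra hne
        apply hd'
        rw [hJDiff] at hd
        exact (hJDaiff d).2 ⟨(hDaiff d).2 ⟨hd.1, hne⟩, hd.2⟩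
      have h4 : ∑ d ∈ JDa, w a d = ∑ d ∈ JD, w a d :=
        Finset.sum_subset hsub fun d hd hd' => hvan d hd hd'
      have h5 : ∑ d ∈ JDa, (w a d) ^ 2 = ∑ d ∈ JD, (w a d) ^ 2 :=
        Finset.sum_subset hsub fun d hd hd' => by rw [hvan d hd hd']; ring
      rw [h3, h4, h5]; ring
    rw [hS1, hS2]
    have hid := chain₃_column_identity JD (fun d => w a d) (fun d => w b d) (fun d => w c d) a₀ b₀ c₀ σ τ na nb nc
      (h01 _) (h01 _) (h01 _) hbudget (Y a) (Y b) (Y c) hYa hYb hYc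
    simp only [lam₁, lama, lamb, lamc] at hid ⊢
    linear_combination Φ * hid
  -- ★ conclusion: the start row lies in the span of the other rows
  apply det_eq_zero_of_row_mem_span Mx i₀
  rw [hrel]
  refine Submodule.add_mem _ (Submodule.add_mem _ ?_ (Submodule.sum_mem _ fun d hd => ?_))
    (Submodule.sum_mem _ fun d hd => Submodule.sum_mem _ fun d' hd' =>
      Submodule.smul_mem _ _ (hspan _ (needdd d hd d' hd')))
  · exact Submodule.add_mem _ (Submodule.add_mem _ (Submodule.add_mem _ (Submodule.add_mem _ (Submodule.add_mem _
      (Submodule.add_mem _ (Submodule.smul_mem _ _ (hspan _ need0)) (Submodule.smul_mem _ _ (hspan _ needa)))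
      (Submodule.smul_mem _ _ (hspan _ needb))) (Submodule.smul_mem _ _ (hspan _ needc)))
      (Submodule.smul_mem _ _ (hspan _ needab))) (Submodule.smul_mem _ _ (hspan _ needac)))
      (Submodule.smul_mem _ _ (hspan _ needbc))
  · exact Submodule.add_mem _ (Submodule.add_mem _ (Submodule.add_mem _ (Submodule.smul_mem _ _ (hspan _ (needd d hd)))
      (Submodule.smul_mem _ _ (hspan _ (needad d hd)))) (Submodule.smul_mem _ _ (hspan _ (needbd d hd))))
      (Submodule.smul_mem _ _ (hspan _ (needcd d hd)))

end SecondShell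

end

end Summit.ValiantsHypothesis.ValiantsHypothesis.Theorems.BarrierLever.HiddenStates
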